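import Summits.ResolutionOfSingularities.ResolutionOfSingularities.Theorems.SplitTowerShape
import Summits.ResolutionOfSingularities.ResolutionOfSingularities.Theorems.PinchTowerChart
import Summits.ResolutionOfSingularities.ResolutionOfSingularities.Theorems.ShallowCutChart

/-!
# SplitTower (T4/·) — THE FIBRE MAP of a Rees chart and the CHART FACTORISATIONS of the split element

Node «SplitTower» of `decomp-res-lens-2` (g34), see `Theorems/MaxContactCutSplitTower.lean`.

* §F  For a quasi-regular family `c = (c_l)_{l < k} ⊆ 𝔪_A` and a chart index `j`, THE FIBRE MAP
  `Φ_j : B_j = A[c/c_j] ↠ κ(A)[X_l : l ≠ j]` — the composite `B_j ↠ (A/(c))[X] ↠ κ(A)[X]` of the quotient dictionary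
  `ShallowCut.chartQuot` with the reduction of coefficients: `Φ(e_l) = X_l`, `Φ(φ a) = ā`, `Φ(φ c_l) = 0`, `Φ`
  surjective, `ker Φ ⊆ 𝔪_A B_j ⊆ 𝔴` for every prime `𝔴` of `B_j` over `𝔪_A`, hence `b ∈ 𝔴 ↔ Φ b ∈ Φ(𝔴)`;
  THE ORIGIN PRIME `𝔴₀` (all `X_l ↦ 0`), unique over `𝔪_A` among primes containing the `e_l`.
* §C  THE CHART FACTORISATIONS `ψ f = tⁿ · H_j` of the split element `f = splitCone z U G n + ε W^k + h` along any ring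
  map `ψ` with `ψ(c_l) = t·u_l`: the tail goes to `(t^{n+1})` in every chart (`map_wtIdeal_le_pow`) and to
  `tⁿ · Wt(u₀, u₁, t; n, k − n)` in the `W`-chart (`map_wtIdeal_le_mul`, the weight ideal REPRODUCES); the cone
  numerators are `splitCone 1 u₁`, `splitCone u₀ 1`, `splitCone u₀ u₁` (tree kernels `splitCone_chartZ/U/W`).
* §I  the fibre images of the three cone numerators: the binary forms `Σ ḡ_i X₁^i`, `Σ ḡ_i X₀^{n-i}`,
  `Σ ḡ_i X₀^{n-i} X₁^i` of the kernels T2.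

Sources: [StacksProject, Tag 0BIQ, Tag 052P]; [Hironaka1964] Ch. III §3; [CossartJannsenSaito2020] Ch. 2.
-/

open IsLocalRing
open Literature.AlgebraicGeometry.Resolution
open Summit.ResolutionOfSingularities.ResolutionOfSingularities.Theorems.SplitCut (splitCone)
open Summit.ResolutionOfSingularities.ResolutionOfSingularities.Theorems.JetCut
  (WtIdeal ladder_weight_step ladder_monomial_identity)

namespace Summit.ResolutionOfSingularities.ResolutionOfSingularities.Theorems.SplitTower

/-! ## §F  The fibre map of a Rees chart -/

section Fibre

open MvPolynomial

variable {A : Type} [CommRing A] [IsLocalRing A] {k : ℕ} (c : Fin k → A) (j : Fin k) (hq : IsQuasiRegular c)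
  (hcm : ∀ l, c l ∈ maximalIdeal A)

/-- The reduction `A/(c) ↠ κ(A)` (`(c) ⊆ 𝔪_A`). [folklore] -/
noncomputable def quotResidue : A ⧸ Ideal.span (Set.range c) →+* ResidueField A :=
  Ideal.Quotient.lift _ (residue A) fun a ha =>
    (residue_eq_zero_iff _).mpr (Ideal.span_le.mpr (by rintro _ ⟨l, rfl⟩; exact hcm l) ha)

/-- `quotResidue (ā) = ā`. [folklore] -/
theorem quotResidue_mk (a : A) : quotResidue c hcm (Ideal.Quotient.mk _ a) = residue A a :=
  Ideal.Quotient.lift_mk _ _ _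

/-- `quotResidue` is surjective. [folklore] -/
theorem quotResidue_surjective : Function.Surjective (quotResidue c hcm) := fun x => by
  obtain ⟨a, rfl⟩ := residue_surjective x
  exact ⟨Ideal.Quotient.mk _ a, quotResidue_mk c hcm a⟩

/-- **THE FIBRE MAP** `Φ_j : B_j ↠ κ(A)[X_l : l ≠ j]` of the Rees chart `B_j = A[c/c_j]`. [cite: StacksProject, Tag 0BIQ] -/
noncomputable def fibreMap : chartRing c j →+* MvPolynomial {i : Fin k // i ≠ j} (ResidueField A) :=
  (MvPolynomial.map (quotResidue c hcm)).comp (ShallowCut.chartQuot c j hq)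

/-- `Φ(e_l) = X_l`. [folklore] -/
theorem fibreMap_gen {l : Fin k} (hl : l ≠ j) : fibreMap c j hq hcm (chartGen c j l) = X ⟨l, hl⟩ := by
  simp [fibreMap, ShallowCut.chartQuot_gen c j hq hl, map_X]

/-- `Φ(φ a) = ā` (a constant). [folklore] -/
theorem fibreMap_base (a : A) : fibreMap c j hq hcm (chartBase c j a) = C (residue A a) := by
  simp [fibreMap, ShallowCut.chartQuot_base, map_C, quotResidue_mk]

/-- `Φ` is surjective. [folklore] -/
theorem fibreMap_surjective : Function.Surjective (fibreMap c j hq hcm) :=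
  (MvPolynomial.map_surjective _ (quotResidue_surjective c hcm)).comp (ShallowCut.chartQuot_surjective c j hq)

/-- **`ker Φ ⊆ 𝔪_A B_j`**: a chart element whose fibre image vanishes lies in the extension of `𝔪_A`.
[cite: StacksProject, Tag 0BIQ] -/
theorem ker_fibreMap_le_map : RingHom.ker (fibreMap c j hq hcm) ≤ (maximalIdeal A).map (chartBase c j) := by
  intro b hb
  rw [RingHom.mem_ker, fibreMap, RingHom.comp_apply, ← RingHom.mem_ker, MvPolynomial.ker_map] at hb
  -- `chartQuot b` has coefficients in `𝔪/(c)`: it is `chartQuot b₁` for some `b₁ ∈ 𝔪_A · B_j`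
  have hK : Ideal.map (C : A ⧸ Ideal.span (Set.range c) →+* _) (RingHom.ker (quotResidue c hcm)) ≤
      Ideal.map (ShallowCut.chartQuot c j hq) (Ideal.map (chartBase c j) (maximalIdeal A)) := by
    rw [Ideal.map_le_iff_le_comap]
    intro x hx
    obtain ⟨a, rfl⟩ := Ideal.Quotient.mk_surjective x
    rw [RingHom.mem_ker, quotResidue_mk, residue_eq_zero_iff] at hx
    rw [Ideal.mem_comap, ← ShallowCut.chartQuot_base c j hq]
    exact Ideal.mem_map_of_mem _ (Ideal.mem_map_of_mem _ hx)
  have hb' := Ideal.mem_comap.mpr (hK hb)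
  rw [Ideal.comap_map_of_surjective _ (ShallowCut.chartQuot_surjective c j hq)] at hb'
  refine (sup_le le_rfl ?_ : Ideal.map (chartBase c j) (maximalIdeal A) ⊔
      Ideal.comap (ShallowCut.chartQuot c j hq) ⊥ ≤ _) hb'
  rw [← RingHom.ker_eq_comap_bot]
  exact ShallowCut.ker_chartQuot_le c j hq (Ideal.mem_map_of_mem _ (hcm j))

/-- **`ker Φ ⊆ 𝔴`** for every ideal `𝔴` of `B_j` over `𝔪_A`. [cite: StacksProject, Tag 0BIQ] -/
theorem ker_fibreMap_le {𝔴 : Ideal (chartRing c j)} (h𝔴 : 𝔴.comap (chartBase c j) = maximalIdeal A) :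
    RingHom.ker (fibreMap c j hq hcm) ≤ 𝔴 :=
  (ker_fibreMap_le_map c j hq hcm).trans (by rw [Ideal.map_le_iff_le_comap, h𝔴])

/-- **The image prime**: for a prime `𝔴` of `B_j` over `𝔪_A`, `Φ(𝔴)` is prime and `b ∈ 𝔴 ↔ Φ b ∈ Φ(𝔴)`.
[cite: StacksProject, Tag 0BIQ] -/
theorem map_fibreMap_isPrime {𝔴 : Ideal (chartRing c j)} [𝔴.IsPrime]
    (h𝔴 : 𝔴.comap (chartBase c j) = maximalIdeal A) :
    (𝔴.map (fibreMap c j hq hcm)).IsPrime ∧ ∀ b, b ∈ 𝔴 ↔ fibreMap c j hq hcm b ∈ 𝔴.map (fibreMap c j hq hcm) := by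
  have hker : RingHom.ker (fibreMap c j hq hcm) ≤ 𝔴 := ker_fibreMap_le c j hq hcm h𝔴
  refine ⟨Ideal.map_isPrime_of_surjective (fibreMap_surjective c j hq hcm) hker, fun b => ⟨Ideal.mem_map_of_mem _, ?_⟩⟩
  intro hb
  have h := Ideal.mem_comap.mpr hb
  rw [Ideal.comap_map_of_surjective _ (fibreMap_surjective c j hq hcm)] at h
  exact (sup_le le_rfl (by rwa [← RingHom.ker_eq_comap_bot]) : 𝔴 ⊔ Ideal.comap _ ⊥ ≤ 𝔴) h

/-- Polynomials without constant term lie in the ideal of the variables. [folklore] -/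
theorem mem_span_X_of_constantCoeff {σ κ : Type} [CommRing κ] {p : MvPolynomial σ κ} (hp : constantCoeff p = 0) :
    p ∈ Ideal.span (Set.range (X : σ → MvPolynomial σ κ)) := by
  rw [show Set.range (X : σ → MvPolynomial σ κ) = X '' Set.univ by simp, mem_ideal_span_X_image]
  intro m hm
  by_cases hm0 : m = 0
  · rw [hm0, mem_support_iff, ← constantCoeff_eq] at hm
    exact (hm hp).elim
  · obtain ⟨i, hi⟩ := DFunLike.ne_iff.mp hm0
    exact ⟨i, Set.mem_univ i, by simpa using hi⟩

/-- **THE ORIGIN PRIME** `𝔴₀ = ker(B_j ↠ κ(A)[X] ↠ κ(A))` (all `X_l ↦ 0`) of the chart `B_j`: THE UNIQUE prime over `𝔪_A`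
containing every `e_l`, `l ≠ j`. [folklore] -/
theorem exists_origin (hq : IsQuasiRegular c) (hcm : ∀ l, c l ∈ maximalIdeal A) : ∃ 𝔴₀ : PrimeSpectrum (chartRing c j), 𝔴₀.asIdeal.comap (chartBase c j) = maximalIdeal A ∧
    (∀ l (hl : l ≠ j), chartGen c j l ∈ 𝔴₀.asIdeal) ∧
      ∀ 𝔴 : Ideal (chartRing c j), 𝔴.IsPrime → 𝔴.comap (chartBase c j) = maximalIdeal A →
        (∀ l, l ≠ j → chartGen c j l ∈ 𝔴) → 𝔴 = 𝔴₀.asIdeal := by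
  set θ : chartRing c j →+* ResidueField A := constantCoeff.comp (fibreMap c j hq hcm) with hθ
  have hθb : ∀ a, θ (chartBase c j a) = residue A a := fun a => by
    simp [hθ, fibreMap_base]
  have hθe : ∀ l (hl : l ≠ j), θ (chartGen c j l) = 0 := fun l hl => by
    simp [hθ, fibreMap_gen c j hq hcm hl]
  have hθs : Function.Surjective θ := fun x => by
    obtain ⟨a, rfl⟩ := residue_surjective x
    exact ⟨chartBase c j a, hθb a⟩
  have hmax : (RingHom.ker θ).IsMaximal := RingHom.ker_isMaximal_of_surjective θ hθs
  refine ⟨⟨RingHom.ker θ, hmax.isPrime⟩, ?_, fun l hl => ?_, fun 𝔴 h𝔴p h𝔴 he => ?_⟩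
  · ext a
    rw [Ideal.mem_comap, RingHom.mem_ker, hθb, residue_eq_zero_iff]
  · exact (RingHom.mem_ker).mpr (hθe l hl)
  · refine (hmax.eq_of_le h𝔴p.ne_top fun b hb => ?_).symm
    -- `Φ b` has no constant term, so lies in `(X_l) = Φ((e_l))`, and `ker Φ ⊆ 𝔴`
    have hb' : fibreMap c j hq hcm b ∈ (Ideal.span (Set.range fun l : {i : Fin k // i ≠ j} => chartGen c j l.1)).map
        (fibreMap c j hq hcm) := by
      rw [Ideal.map_span, ← Set.range_comp]
      have hX : (fibreMap c j hq hcm ∘ fun l : {i : Fin k // i ≠ j} => chartGen c j l.1) = X :=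
        funext fun l => fibreMap_gen c j hq hcm l.2
      rw [hX]
      exact mem_span_X_of_constantCoeff (by simpa [hθ] using hb)
    have h2 := Ideal.mem_comap.mpr hb'
    rw [Ideal.comap_map_of_surjective _ (fibreMap_surjective c j hq hcm)] at h2
    refine (sup_le (Ideal.span_le.mpr ?_) ?_ : _ ⊔ Ideal.comap _ ⊥ ≤ 𝔴) h2
    · rintro _ ⟨⟨l, hl⟩, rfl⟩; exact he l hl
    · rw [← RingHom.ker_eq_comap_bot]; exact ker_fibreMap_le c j hq hcm h𝔴

end Fibre

/-! ## §C  The chart factorisations of the split element -/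

section ChartFactor

variable {A B : Type} [CommRing A] [CommRing B]

/-- Ring maps commute with the split cone. [folklore] -/
theorem map_splitCone (ψ : A →+* B) (z U : A) (G : ℕ → A) (n : ℕ) :
    ψ (splitCone z U G n) = splitCone (ψ z) (ψ U) (fun i => ψ (G i)) n := by
  simp [splitCone, map_sum]

/-- **The tail in any chart**: along `ψ` with `ψ(c_l) = t·u_l`, the weight ideal `Wt(c; n, k, nk + 1)` goes into
`(t^{n+1})` (every tail monomial has degree `≥ n + 1`, `ladder_weight_step`). [folklore] -/
theorem map_wtIdeal_le_pow (ψ : A →+* B) (c : Fin 3 → A) (t : B) (u : Fin 3 → B) (hu : ∀ l, ψ (c l) = t * u l)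
    {n k : ℕ} (hnk : n ≤ k) : (WtIdeal c n k (n * k + 1)).map ψ ≤ Ideal.span {t ^ (n + 1)} := by
  rw [WtIdeal, Ideal.map_span]
  refine Ideal.span_le.mpr ?_
  rintro _ ⟨x, ⟨a, b, e, hw, rfl⟩, rfl⟩
  have hdeg := (ladder_weight_step hnk hw).1
  obtain ⟨m, hm⟩ := Nat.exists_eq_add_of_le hdeg
  rw [SetLike.mem_coe, Ideal.mem_span_singleton]
  refine ⟨t ^ m * (u 0 ^ a * u 1 ^ b * u 2 ^ e), ?_⟩
  simp only [map_mul, map_pow, hu]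
  calc (t * u 0) ^ a * (t * u 1) ^ b * (t * u 2) ^ e = t ^ (a + b + e) * (u 0 ^ a * u 1 ^ b * u 2 ^ e) := by ring
    _ = t ^ (n + 1) * (t ^ m * (u 0 ^ a * u 1 ^ b * u 2 ^ e)) := by rw [hm, pow_add]; ring

/-- **The tail in the `W`-chart**: along `ψ` with `ψ z = t·u₀`, `ψ U = t·u₁`, `ψ W = t`, the weight ideal
`Wt(c; n, k, nk + 1)` goes into `tⁿ · Wt((u₀, u₁, t); n, k − n, n(k − n) + 1)` — THE WEIGHT IDEAL REPRODUCES with the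
exponent `k − n` (`ladder_monomial_identity`, `ladder_weight_step`). [folklore] -/
theorem map_wtIdeal_le_mul (ψ : A →+* B) (c : Fin 3 → A) (t : B) (u : Fin 3 → B) (hu : ∀ l, ψ (c l) = t * u l)
    (hu2 : u 2 = 1) {n k : ℕ} (hnk : n ≤ k) :
    (WtIdeal c n k (n * k + 1)).map ψ ≤
      Ideal.span {t ^ n} * WtIdeal ![u 0, u 1, t] n (k - n) (n * (k - n) + 1) := by
  rw [WtIdeal, Ideal.map_span]
  refine Ideal.span_le.mpr ?_
  rintro _ ⟨x, ⟨a, b, e, hw, rfl⟩, rfl⟩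
  obtain ⟨hdeg, hw'⟩ := ladder_weight_step hnk hw
  have hx : ψ (c 0 ^ a * c 1 ^ b * c 2 ^ e) = t ^ n * (u 0 ^ a * u 1 ^ b * t ^ (a + b + e - n)) := by
    simp only [map_mul, map_pow, hu, hu2, mul_one]
    exact ladder_monomial_identity t (u 0) (u 1) (by omega)
  rw [SetLike.mem_coe, hx]
  refine Ideal.mul_mem_mul (Ideal.mem_span_singleton_self _) (Ideal.subset_span ⟨a, b, a + b + e - n, hw', ?_⟩)
  simp

variable (ψ : A →+* B) (c : Fin 3 → A) (t : B) (u : Fin 3 → B) (G : ℕ → A) (ε h : A) {n k : ℕ}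

/-- **`W`-CHART FACTORISATION** (`u₂ = 1`): `ψ f = tⁿ · (splitCone u₀ u₁ G^ψ n + ψε · t^{k−n} + h')` with the new
tail `h' ∈ Wt((u₀, u₁, t); n, k − n, n(k − n) + 1)`. [folklore] -/
theorem split_factor_W (hu : ∀ l, ψ (c l) = t * u l) (hu2 : u 2 = 1) (hnk : n ≤ k)
    (hh : h ∈ WtIdeal c n k (n * k + 1)) :
    ∃ h' ∈ WtIdeal ![u 0, u 1, t] n (k - n) (n * (k - n) + 1),
      ψ (splitCone (c 0) (c 1) G n + ε * c 2 ^ k + h) =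
        t ^ n * (splitCone (u 0) (u 1) (fun i => ψ (G i)) n + ψ ε * t ^ (k - n) + h') := by
  obtain ⟨h', hh', hth'⟩ := Ideal.mem_span_singleton_mul.mp
    (map_wtIdeal_le_mul ψ c t u hu hu2 hnk (Ideal.mem_map_of_mem ψ hh))
  refine ⟨h', hh', ?_⟩
  have h2 : ψ (c 2) = t := by rw [hu 2, hu2, mul_one]
  rw [map_add, map_add, ← hth', map_splitCone, hu 0, hu 1, map_mul, map_pow, h2,
    SplitCut.split_chart_identity _ _ _ _ _ hnk]
  ring

/-- **`W`-CHART FACTORISATION, coarse form** (`u₂ = 1`, `n + 1 ≤ k`): `ψ f = tⁿ · (splitCone u₀ u₁ G^ψ n + t·r)`.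
[folklore] -/
theorem split_factor_W' (hu : ∀ l, ψ (c l) = t * u l) (hu2 : u 2 = 1) (hk : n + 1 ≤ k)
    (hh : h ∈ WtIdeal c n k (n * k + 1)) :
    ∃ r : B, ψ (splitCone (c 0) (c 1) G n + ε * c 2 ^ k + h) =
      t ^ n * (splitCone (u 0) (u 1) (fun i => ψ (G i)) n + t * r) := by
  obtain ⟨r₁, hr₁⟩ := Ideal.mem_span_singleton'.mp
    (map_wtIdeal_le_pow ψ c t u hu (by omega) (Ideal.mem_map_of_mem ψ hh))
  obtain ⟨d, hd⟩ := Nat.exists_eq_add_of_le hk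
  have h2 : ψ (c 2) = t := by rw [hu 2, hu2, mul_one]
  refine ⟨ψ ε * t ^ d + r₁, ?_⟩
  rw [map_add, map_add, ← hr₁, map_splitCone, hu 0, hu 1, map_mul, map_pow, h2, SplitCut.splitCone_chartW, hd]
  ring

/-- **`U`-CHART FACTORISATION** (`u₁ = 1`, `n + 1 ≤ k`): `ψ f = tⁿ · (splitCone u₀ 1 G^ψ n + t·r)`. [folklore] -/
theorem split_factor_U (hu : ∀ l, ψ (c l) = t * u l) (hu1 : u 1 = 1) (hk : n + 1 ≤ k)
    (hh : h ∈ WtIdeal c n k (n * k + 1)) :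
    ∃ r : B, ψ (splitCone (c 0) (c 1) G n + ε * c 2 ^ k + h) =
      t ^ n * (splitCone (u 0) 1 (fun i => ψ (G i)) n + t * r) := by
  obtain ⟨r₁, hr₁⟩ := Ideal.mem_span_singleton'.mp
    (map_wtIdeal_le_pow ψ c t u hu (by omega) (Ideal.mem_map_of_mem ψ hh))
  obtain ⟨d, hd⟩ := Nat.exists_eq_add_of_le hk
  have h1 : ψ (c 1) = t := by rw [hu 1, hu1, mul_one]
  refine ⟨ψ ε * t ^ d * u 2 ^ k + r₁, ?_⟩
  rw [map_add, map_add, ← hr₁, map_splitCone, hu 0, h1, map_mul, map_pow, hu 2, SplitCut.splitCone_chartU, hd]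
  ring

/-- **`z`-CHART FACTORISATION** (`u₀ = 1`, `n + 1 ≤ k`): `ψ f = tⁿ · (splitCone 1 u₁ G^ψ n + t·r)`. [folklore] -/
theorem split_factor_Z (hu : ∀ l, ψ (c l) = t * u l) (hu0 : u 0 = 1) (hk : n + 1 ≤ k)
    (hh : h ∈ WtIdeal c n k (n * k + 1)) :
    ∃ r : B, ψ (splitCone (c 0) (c 1) G n + ε * c 2 ^ k + h) =
      t ^ n * (splitCone 1 (u 1) (fun i => ψ (G i)) n + t * r) := by
  obtain ⟨r₁, hr₁⟩ := Ideal.mem_span_singleton'.mp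
    (map_wtIdeal_le_pow ψ c t u hu (by omega) (Ideal.mem_map_of_mem ψ hh))
  obtain ⟨d, hd⟩ := Nat.exists_eq_add_of_le hk
  have h0 : ψ (c 0) = t := by rw [hu 0, hu0, mul_one]
  refine ⟨ψ ε * t ^ d * u 2 ^ k + r₁, ?_⟩
  rw [map_add, map_add, ← hr₁, map_splitCone, h0, hu 1, map_mul, map_pow, hu 2, SplitCut.splitCone_chartZ, hd]
  ring

end ChartFactor

/-! ## §I  The fibre images of the cone numerators -/

section FibreImage

open MvPolynomial

variable {A : Type} [CommRing A] [IsLocalRing A] (c : Fin 3 → A) (hq : IsQuasiRegular c)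
  (hcm : ∀ l, c l ∈ maximalIdeal A) (G : ℕ → A) (n : ℕ)

end FibreImage

end Summit.ResolutionOfSingularities.ResolutionOfSingularities.Theorems.SplitTower
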